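import Summits.CriticalPhenomena.CardyFormulaZ2.Theorems.CardyBondTriangularBondTriangularCardyKiteBOrbit
import Summits.CriticalPhenomena.CardyFormulaZ2.Theorems.CardyBondTriangularBondTriangularCardyBlueArmStart
import Summits.CriticalPhenomena.CardyFormulaZ2.Theorems.CardyBondTriangularBondTriangularCardyBlueArmCycleFalse
import HarnessLib

/-!
# Route CardyBondTriangular · crux `BondTriangularCardy` · line `birth`: the blue arm of Claim 10 for the Chayes–Lei separating events, frame of `A₀`

Helper of the stub `stub_blueArm`. **Claim 10 of Bollobás–Riordan (*Percolation* (2006), Ch. 7,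
pp. 177–179), blue arm, for the Chayes–Lei hexagon model with half-edge connectivity**, in the
frame where the target arc is `A₀`: if `E⁰(z) ∖ E⁰(w)` holds, `z` the dual neighbour of the face
`w ⊆ G` across its side `x₁x₂`, then a hexagon of `w` is joined to a hexagon of the arc `A₀` by
a path of hexagons sharing blue (half-)edges (`clBlueGraph`). Proof: the separating yellow path
uses the bond `x₁x₂`, with `w` on its left (`TriClaim10Prep`, colour-free); the kite interface
passes by `w` (`exists_start`); following it (`blueArm_or_cycle`) gives the blue arm — the left
kites —, the interface closing up being impossible (`cyc_false`).

## References

* B. Bollobás, O. Riordan, *Percolation*, CUP (2006), Ch. 7, Claim 10 pp. 177–179.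
* L. Chayes, H. K. Lei, Rev. Math. Phys. 19 (2007), §2.1–2.3.
-/

namespace Summit.CriticalPhenomena.CardyFormulaZ2.Theorems.BondTriangularCardyLine.KiteB

open Finset Literature.Probability.Percolation Literature.Probability.LatticeModels

/-- **The blue arm of Claim 10 in the frame of `A₀`** for the Chayes–Lei separating events
(registered anchor of this file). -/
theorem clBlueArm_zero : ∀ (D : Literature.Probability.Percolation.TriMarkedDomain 3) (w : Literature.Probability.LatticeModels.HexVertex) (r : Fin 3), Literature.Probability.LatticeModels.hexFaceVertices w ⊆ D.verts → D.clSepEvent 0 (Literature.Probability.Percolation.oppFace w r) \ D.clSepEvent 0 w ⊆ {σ | ∃ k : Fin 3, ∃ u ∈ D.arc 0, (Literature.Probability.Percolation.clBlueGraph σ).Reachable (Literature.Probability.Percolation.faceVertex w k) u} := by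
  classical
  intro D w r hw σ hσ
  obtain ⟨hz, hnw⟩ := hσ
  obtain ⟨du, dv, P, hP, hu, hv, hyu, hyv, hsupp, hdarts, hsep⟩ := hz
  change du ∈ D.stretch 1 at hu
  change dv ∈ D.stretch 2 at hv
  set L := #(triBdryDarts D.verts) with hL
  have h12 := D.pos_lt_pos₃ (show (1 : Fin 3) < 2 by decide)
  have h2L := D.pos_lt 2
  -- positions of the end darts
  obtain ⟨nu, hnu, hdu⟩ : ∃ nu, (D.pos 1 ≤ nu ∧ nu < D.pos 2) ∧ triBdryIter D.verts D.base nu = du := by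
    unfold TriMarkedDomain.stretch at hu
    rw [D.nextPos_of_lt₃ 1 (by decide)] at hu
    simp only [Finset.mem_image, Finset.mem_Ico] at hu
    obtain ⟨n, hn, h⟩ := hu
    exact ⟨n, hn, h⟩
  obtain ⟨nv, hnv, hdv⟩ : ∃ nv, (D.pos 2 ≤ nv ∧ nv < L) ∧ triBdryIter D.verts D.base nv = dv := by
    unfold TriMarkedDomain.stretch at hv
    rw [D.nextPos_two₃] at hv
    simp only [Finset.mem_image, Finset.mem_Ico] at hv
    obtain ⟨n, hn, h⟩ := hv
    exact ⟨n, hn, h⟩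
  -- stretch membership from positions
  have hstr1 : ∀ {n}, D.pos 1 ≤ n → n < D.pos 2 → triBdryIter D.verts D.base n ∈ D.stretch (0 + 1) := by
    intro n h1 h2
    have := D.iter_mem_stretch₃ n
    have hs : D.stretchIdx₃ n = 1 := by
      unfold TriMarkedDomain.stretchIdx₃; rw [Nat.mod_eq_of_lt (by omega), if_neg (by omega), if_pos h2]
    rwa [hs] at this
  have hstr2 : ∀ {n}, D.pos 2 ≤ n → n < L → triBdryIter D.verts D.base n ∈ D.stretch (0 + 2) := by
    intro n h1 h2
    have := D.iter_mem_stretch₃ n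
    have hs : D.stretchIdx₃ n = 2 := by
      unfold TriMarkedDomain.stretchIdx₃; rw [Nat.mod_eq_of_lt h2, if_neg (by omega), if_neg (by omega)]
    rwa [hs] at this
  -- the path, as a list
  set Q := P.support with hQ
  have hQne : Q ≠ [] := P.support_ne_nil
  have hQnd : Q.Nodup := hP.support_nodup
  have hQch : List.IsChain triGraph.Adj Q := P.isChain_adj_support
  have hQG : ∀ s ∈ Q, s ∈ D.verts := fun s hs => (hsupp s hs).1
  have hQB : ∀ s ∈ Q, σ s ≠ CLHexState.B := fun s hs => (hsupp s hs).2
  have hQY : ∀ d ∈ pathDarts Q, (clYellowGraph σ).Adj d.1 d.2 := by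
    rintro ⟨x, y⟩ hd
    obtain ⟨d', hd', he⟩ := (mem_pathDarts_support_iff P).1 hd
    have := hdarts d' hd'
    have h1 : d'.fst = x := congrArg Prod.fst he
    have h2 : d'.snd = y := congrArg Prod.snd he
    rw [h1, h2] at this
    exact this
  have hQhead : Q.head hQne = (triBdryIter D.verts D.base nu).1 := by rw [hdu]; exact P.head_support
  have hQlast : Q.getLast hQne = (triBdryIter D.verts D.base nv).1 := by rw [hdv]; exact P.getLast_support
  have hYu : YellowTowards σ (triBdryIter D.verts D.base nu) := by rw [hdu]; exact hyu
  have hYv : YellowTowards σ (triBdryIter D.verts D.base nv) := by rw [hdv]; exact hyv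
  have hsep' : Separates D.verts {e : Sym2 (Site 2) | ∃ d ∈ pathDarts Q, e = s(d.1, d.2)} (oppFace w r) (D.stretch 0) := by
    rw [hQ, ← setOf_mem_edges_eq P]; exact hsep
  -- no yellow path separates `w` (general ends)
  have hnotwG : ∀ (Q' : List (Site 2)) (hne : Q' ≠ []), Q'.Nodup → List.IsChain triGraph.Adj Q' →
      (∀ s ∈ Q', s ∈ D.verts ∧ σ s ≠ CLHexState.B) → (∀ d ∈ pathDarts Q', (clYellowGraph σ).Adj d.1 d.2) →
      ∀ nu' nv' : ℕ, D.pos 1 ≤ nu' → nu' < D.pos 2 → D.pos 2 ≤ nv' → nv' < L →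
      Q'.head hne = (triBdryIter D.verts D.base nu').1 → YellowTowards σ (triBdryIter D.verts D.base nu') →
      Q'.getLast hne = (triBdryIter D.verts D.base nv').1 → YellowTowards σ (triBdryIter D.verts D.base nv') →
      ¬ Separates D.verts {e : Sym2 (Site 2) | ∃ d ∈ pathDarts Q', e = s(d.1, d.2)} w (D.stretch 0) := by
    intro Q' hne hnd hch hGB hY nu' nv' h1 h2 h3 h4 hh hYu' hl hYv' hS
    apply hnw
    obtain ⟨p, hp⟩ := exists_walk_of_isChain Q' hne hch
    refine ⟨triBdryIter D.verts D.base nu', triBdryIter D.verts D.base nv', p.copy hh hl, ?_, hstr1 h1 h2, hstr2 h3 h4,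
      hYu', hYv', ?_, ?_, ?_⟩
    · exact SimpleGraph.Walk.IsPath.mk' (by rw [SimpleGraph.Walk.support_copy, hp]; exact hnd)
    · intro x hx
      rw [SimpleGraph.Walk.support_copy, hp] at hx
      exact hGB x hx
    · intro d hd
      have : (d.fst, d.snd) ∈ pathDarts (p.copy hh hl).support := (mem_pathDarts_support_iff _).2 ⟨d, hd, rfl⟩
      rw [SimpleGraph.Walk.support_copy, hp] at this
      exact hY _ this
    · rwa [setOf_mem_edges_eq, SimpleGraph.Walk.support_copy, hp]
  -- … in particular no yellow path with the ends of `Q`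
  have hnotw : ∀ (Q' : List (Site 2)) (hne : Q' ≠ []), Q'.Nodup → List.IsChain triGraph.Adj Q' →
      (∀ s ∈ Q', s ∈ D.verts ∧ σ s ≠ CLHexState.B) → (∀ d ∈ pathDarts Q', (clYellowGraph σ).Adj d.1 d.2) →
      Q'.head hne = Q.head hQne → Q'.getLast hne = Q.getLast hQne →
      ¬ Separates D.verts {e : Sym2 (Site 2) | ∃ d ∈ pathDarts Q', e = s(d.1, d.2)} w (D.stretch 0) :=
    fun Q' hne hnd hch hGB hY hh hl => hnotwG Q' hne hnd hch hGB hY nu nv hnu.1 hnu.2 hnv.1 hnv.2 (hh.trans hQhead) hYu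
      (hl.trans hQlast) hYv
  -- Step 1: the path uses the bond `x₁x₂`, `w` on its left
  have hns := hnotw Q hQne hQnd hQch (fun s hs => ⟨hQG s hs, hQB s hs⟩) hQY rfl rfl
  have hab := D.sym2_mem_bondSet_of_separates hw hsep' hns
  have hQ2 : 2 ≤ Q.length := by
    obtain ⟨d₀, hd₀, -⟩ := hab
    exact two_le_length_of_mem_pathDarts hd₀
  have hC := D.isTriLoop_chordLoop_frame hQne hQnd hQch hQG hQ2 hnu.2 hnv.1 hnv.2 hQhead hQlast
  obtain ⟨hπw, hdart, -⟩ := D.faceLabel_chordLoop_w hQne hQG hnu.1 hnu.2 hnv.1 hnv.2 hC hab hns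
  -- Steps 2–3: the interface passes by `w`; follow it
  obtain ⟨s₀, p₀, hs₀, hs₀adm, hs₀G, hs₀c, hs₀ρ, hp₀, hp₀adm, hp₀G, hp₀s, hp₀ρ, hcells⟩ :=
    exists_start D hQne hQnd hQch hQG hQB hQY hnu.1 hnu.2 hnv.1 hnv.2 hC hπw hnotw hw hdart
  rcases blueArm_or_cycle hs₀ hs₀adm hs₀G with ⟨n, hreach, harc⟩ | ⟨N, hN, hret, hcyc⟩
  · -- the blue arm: the left kites
    have hk : ∃ k, s₀.leftCell = faceVertex w k := by
      rcases hcells with h | h | h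
      exacts [⟨r, h⟩, ⟨r + 1, h⟩, ⟨r + 2, h⟩]
    obtain ⟨k, hk⟩ := hk
    exact ⟨k, _, harc, hk ▸ hreach⟩
  · -- Step 4: the interface cannot close up
    exfalso
    obtain ⟨L₁, L₂, hQeq⟩ := exists_append_of_mem_pathDarts hdart
    set orb := partialOrbit (fun d => if (succ (kcol D σ) d).leftCell ∈ D.verts then some (succ (kcol D σ) d) else none) s₀
      with horbdef
    have horb : ∀ k < N, succ (kcol D σ) (orb k) = orb (k + 1) := fun k hk => (hcyc k hk).2.2.2.1
    have hiface : ∀ k < N, iface (kcol D σ) (orb k) = true := fun k hk => (hcyc k hk).1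
    have hadm : ∀ k < N, (orb k).adm = true := fun k hk => (hcyc k hk).2.1
    have hleft : ∀ k < N, (orb k).leftCell ∈ D.verts := fun k hk => (hcyc k hk).2.2.1
    have hretG : (orb N).leftCell ∈ D.verts := by rw [show orb N = s₀ from hret]; exact hs₀G
    have h0 : orb 0 = s₀ := rfl
    have hbc0 : (orb 0).leftCorner = w := by rw [h0]; exact hs₀c
    have hρ0 : (orb 0).rightCell = faceVertex w (r + 2) := by rw [h0]; exact hs₀ρ
    have hρN : (orb (N - 1)).rightCell = faceVertex w (r + 1) := by
      have hlast := horb (N - 1) (by omega)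
      rw [Nat.sub_add_cancel hN, show orb N = s₀ from hret, ← hp₀s] at hlast
      have := succ_inj_of_iface (hiface (N - 1) (by omega)) (hadm (N - 1) (by omega)) (hleft (N - 1) (by omega))
        hp₀ hp₀adm hp₀G hlast
      rw [this]; exact hp₀ρ
    exact cyc_false D horb hiface hadm hleft hretG hbc0 hnotwG hQeq hQnd hQch hQG hQB hQY hnu.1 hnu.2 hnv.1 hnv.2 hQhead hYu
      hQlast hYv hC hπw (leftFace_succ_succ w r) hN hρ0 hρN

end Summit.CriticalPhenomena.CardyFormulaZ2.Theorems.BondTriangularCardyLine.KiteB
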